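import Summits.HodgeConjecture.HodgeConjecture.Theses.PadicSemiregularLift
import Summits.HodgeConjecture.HodgeConjecture.Theses.TropicalCuspLift
import Summits.HodgeConjecture.HodgeConjecture.Theorems.HodgeAbelianVarieties.Negative.ExtremeCodimensions
import Summits.HodgeConjecture.HodgeConjecture.Theorems.PadicSemiregularLiftHodgeAbelianVarietiesStubSplitSixfolds
import Literature.AlgebraicGeometry.HodgeTheory.WeilClasses
import Literature.AlgebraicGeometry.HodgeTheory.MotivatedClasses
import Literature.AlgebraicGeometry.Motives.HyperbolicWeilType
import Literature.AlgebraicGeometry.Motives.AbelianVarietyProjectiveChart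

/-!
# Skeleton line `e-step-secant-induction` for crux `HodgeAbelianVarieties` (stmt-HodgeConjecture-1333)

Route `PadicSemiregularLift`, crux r4 (typed OUTPUT item)
`HodgeAbelianVarieties := ∀ A : AbelianVariety ℂ, HodgeConjectureFor A.dim A.X` — the Hodge conjecture
for every complex abelian variety (= the summit restricted to abelian varieties:
`Negative.iff_hodgeConjecture_restricted`, landed p70486).

## The line (crux idea `e-step-secant-induction`, crux-ideate r1 ideator 2; triage r1: 3 × pass)

THE E-STEP. Markman (arXiv:2502.03415 §1.2–§1.5, Thm 1.5.1; survey arXiv:2509.23403 §4, §11) proves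
the Weil classes on every polarized abelian SIXFOLD of SPLIT Weil type (`K = ℚ(√-d)`, all `d`) from
two `G`-equivariant SECANT SHEAVES `F₁, F₂` on a principally polarized abelian THREEFOLD `X = J(C₃)`
satisfying his Hochschild criterion "`ker ev_F = ann ch(F)`, `ev_F` onto the invariants" (Lemma 11.3,
Prop. 11.5), transported to the anchor `X × X̂` by Orlov's equivalence and deformed by the
Buchweitz–Flenner/Pridham semiregularity theorem over the whole `9`-dimensional Weil moduli; he stops
at `dim X ≤ 3` ("we are currently able to handle [semiregularity] only for `dim(X) ≤ 3`", §11; genus-4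
candidates "yet to be checked", §12). The idea replaces "new curve geometry per genus" by ONE
inductive sheaf construction `X ↦ X × E` (`E` any elliptic curve, `Θ' = Θ ⊞ Θ_E`; §1.2 of
arXiv:2502.03415 needs only an AMPLE class, so the decomposable anchor is legitimate): since
`e^{√-qΘ'} = e^{√-qΘ}(1 + √-q[o])` the secant plane of `X × E` is
`B' = ⟨α⊠1 − qβ⊠[o], β⊠1 + α⊠[o]⟩`, and a secant sheaf `F` on `X` (`ch F = aα + bβ`) becomes a secant
sheaf on `X × E` by one elementary (Hecke) modification along fibres `X × {p_j}`:
`F' := ker(F ⊠ 𝒪_E(m·p) → ⊕ⱼ Q ⊠ 𝒪_{p_j})` with `Q` a secant (sheaf or derived) quotient of `F`,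
`k·ch Q = (ma − b)α + (mb + qa)β` ⟹ `ch F' = aα' + bβ'` (verified by all three triagers). The criterion is
Künneth-stable (Markman's own step, survey p.19) and FM-invariant, so the WHOLE inductive weight sits on
one local question: does the criterion (kernel identity AND surjectivity onto `G × G_E`-invariants, incl.
the `Ext¹`-generation part of Prop. 11.5) survive one Hecke modification by a secant quotient along a
`G_E`-orbit of fibres? Output of the machine at level `n+1`: Weil classes on every SPLIT polarized
Weil-type `2(n+1)`-fold (one split component per `(K, n+1)` up to isogeny, van Geemen / Deligne–Milne;
isogeny descent is PROVED in the tree, `WeilClassesIsogenyDescent`); DESCENDING (Schoen 1998 §10 =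
Markman §11.5 Step 2: product with a Weil surface of complementary discriminant) then gives ALL
Weil-type `2n`-folds; the complement "Weil classes (imaginary quadratic, all `n`, `d`) ⟹ HC(AV)" is
André 1992 for CM abelian varieties dominated by imaginary-quadratic Weil types plus an OPEN transport
(Weil classes for higher-degree CM fields, Markman survey Thm 1.4; CM-to-general), carried as the parked
stub `stub_weilSectorSuffices` exactly as `TropicalCuspLift.Assembly` carries it at summit level.

TYPING DECISION (triage r1-1/r1-2/r1-3 common hazard, honoured): the object-level criterion has NO genuine
carrier in the tree (`SemiregularityData`/`TwistedSemiregularityData`/`ChernCharacterBetti` are all-data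
hypothesis structures; any `∃`-over-structure seed predicate is junk-inhabitable, shown in TRIAGE-r1-2/3 for
`HasBlochWeilSeed`), so every stub is stated at CLASS level on REAL carriers (`weilClassesOf`,
`algebraicClasses`, `IsRationalClass`, `IsOfHodgeType`, `IsHyperbolicWeilType`, `IsPolarizationClass`);
the E-step induction on OBJECTS lives inside `stub_eTower` (and its calibration inside
`stub_splitSixfolds`) and is spelled out in the line card `Lines/e-step-secant-induction.md`. The ideator's
`WeilAlgebraicHyperbolic` (IdeatorTwoSketch.lean) was MIS-TYPED — it allowed `h = 0`, for which every
`φ`-stable rational half-frame is isotropic, so it silently equalled `WeilAlgebraicAll`; here a SPLIT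
TRIPLE carries a polarization class (`IsPolarizationClass`: rational, divisorial, hard Lefschetz — the
tree's rendering; positivity has no carrier) that is `φ`-compatible (`φ^* h = d·h`).

`HodgeAbelianVarieties_of` composes the four stubs into the crux BY NAME (kernel-checked, no `sorry` outside the
stubs; lead a1 reshape gen 2, 2026-08-16: hypothesis-free composition + stub 4 typed through the named def
`WeilSectorSuffices` — signatures of stubs 1–3 unchanged);
`weilSixfolds_of` records the line's FIRST NEW OUTPUT in the tree's own terms: split eightfolds
(`stub_eTower` at `n = 4`) + descending ⟹ `TropicalCuspLift.WeilSixfolds` (stmt-HodgeConjecture-2524, the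
printed frontier: sixfolds of discriminant `≠ -1`, arXiv:2603.20268 p.3).

## Disproof used (cdisprove `Disproof.lean`, 2026-08-15T23:37Z, NO KILL; landed
`Theorems/HodgeAbelianVarieties/Negative/ExtremeCodimensions.lean`, p70486 — IMPORTED here)
* `iff_hodgeConjecture_restricted` / `not_hodgeConjecture_of_not`: the crux is HC restricted to AV; a
  line through the Weil sector MUST carry the complement — `stub_weilSectorSuffices` is that edge, named.
* `hodgeAbelianVarieties_iff_deepMiddle`: a counterexample needs `2 ≤ p`, `2p ≤ dim A` — consistent: the
  line works at `p = n` on `2n`-folds, `n ≥ 3` (`stub_splitSixfolds`, `stub_eTower`), and descends.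
* Disproof §3 `weilItems_of` / `not_of_not_weilSixfolds` (work file): the crux IMPLIES
  `TropicalCuspLift.WeilClassesAlgebraic ∧ WeilSixfolds`; here the converse bookkeeping is proved
  (`weilClassesAlgebraic_of`, `weilSixfolds_of`): the Weil part of the skeleton is NECESSARY, not padding.
* `not_integralSaturationOnAbelianVarieties` (EdGFS 2025): honoured — every stub concludes membership in
  the `ℂ`-span `algebraicClasses` of RATIONAL classes; no integral statement (`κ = ch·e^{-c₁/r}` has
  denominators; `μ_r`-gerbes as in survey §2).
* `kaehler_analogue_fails` (Voisin 2002) / `_false_without_proper` / `_false_without_groupLaw`: honoured —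
  binders are `AbelianVariety ℂ` (proper, group law, projective PROVED), families are the algebraic polarized
  Weil families; "the line uses projectivity at `stub_eTower`/`stub_splitSixfolds`" (BF over an algebraic base).
* `not_allHodgeTypeClassesAlgebraicOnAbelianVarieties`: honoured — `IsRationalClass c` is a hypothesis of
  `WeilAlgebraicFor`.
* `ledger negatives --problem HodgeConjecture` (ELineConnectivity, DerivedTorelliFermat K3): no stub is an
  instance. Route-internal refutations (rattack-1498-0 Godeaux–Serre, rattack-1805-0 twist-rigidity):
  not met (no p-adic statement in this line).
-/

set_option linter.dupNamespace false

noncomputable section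

open CategoryTheory
open Literature.AlgebraicGeometry Literature.AlgebraicGeometry.Motives
  Literature.AlgebraicGeometry.HodgeTheory

namespace Summit.HodgeConjecture.HodgeConjecture.Cruxes.HodgeAbelianVarieties.EStepSecantInduction

/-! ### Vocabulary (real carriers only)

Gen 3 (lead a1, after wave 2 worker 1, 2026-08-16): the five class-level predicates `WeilAlgebraicFor`,
`WeilAlgebraicAll`, `IsSplitWeilTriple`, `WeilAlgebraicSplit`, `weilAlgebraicSplit_of_all` are no longer declared
here — they are LANDED, byte-identical, as `Theorems/PadicSemiregularLiftHodgeAbelianVarietiesEStepDefs.lean`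
(p93851, same namespace, imported transitively) so that every helper file speaks one copy. Worker 1 showed the
planner's split predicate is MISSTATED for the purpose of stub 1: `IsPolarizationClass` carries no positivity
(`Stubs.isSplitWeilTriple_smul_iff`: invariant under `h ↦ c • h`, `c ∈ ℚˣ`), so `WeilAlgebraicSplit 3 d` quantifies
over indefinite classes that Markman's Thm 1.5.1 does not cover. The tree's own convention for "polarized of split
Weil type" is the `K`-SYMMETRISED HYPERPLANE CLASS `d·e^*a + φ^*(e^*a)` of a projective embedding `e` and a non-zero
rational `a ∈ H²(ℙᴺ)` (named facts `Markman2025_weilClasses_algebraic_hyperbolicSixfold`,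
`Markman2025_exists_weilTypeSurface_prod_isHyperbolicWeilType`, `Schoen1998_weilClasses_algebraic_of_prod_surface`),
rendered for this line as `Stubs.WeilAlgebraicSplitHyperplane n d` (LANDED p94589,
`Theorems/PadicSemiregularLiftHodgeAbelianVarietiesStubSplitSixfolds.lean`). Gen 3 RESHAPES stubs 1–3 over it:
stub 1 becomes the literature fact itself (Markman Thm 1.5.1 — closing it = discharging the fact; its image
`∀ d, 0 < d → WeilAlgebraicSplitHyperplane 3 d` is PROVED glue, `Stubs.weilAlgebraicSplitHyperplane_three_iff_markman`),
stub 2 (the tower) concludes the hyperplane-typed split sector for `n ≥ 4`, stub 3 (descending) consumes it at `n + 1`.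
Stub 4 and the composition are unchanged. -/

/-- The statement of `stub_weilSectorSuffices` (named, so that no theorem but `HodgeAbelianVarieties_of` has
the crux as its conclusion head; lead a1 reshape gen 2): the imaginary-quadratic Weil sector
(`TropicalCuspLift.WeilClassesAlgebraic`, stmt-HodgeConjecture-2522) implies the crux. -/
def WeilSectorSuffices : Prop :=
  Summit.HodgeConjecture.HodgeConjecture.Theses.TropicalCuspLift.WeilClassesAlgebraic →
    Summit.HodgeConjecture.HodgeConjecture.Theses.PadicSemiregularLift.HodgeAbelianVarieties

/-! ### The four registered stubs (gen 3) -/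

/-- STUB 1 (gen 3; XL to DISCHARGE, TRUE IN PRINT — it IS the print) — **Markman's Theorem 1.5.1 as recorded in
the tree**: `Literature…Markman2025_weilClasses_algebraic_hyperbolicSixfold` (arXiv:2502.03415 Thm 1.5.1: the
Weil classes of every abelian SIXFOLD of Weil type, any `K = ℚ(√-d)`, that is hyperbolic (= split,
discriminant `-1`) for a `K`-symmetrised hyperplane class, are algebraic). Registered as a stub because the line
consumes exactly this fact and nothing weaker closes its `n = 3` base; closing the stub = proving the named fact
(`theorem …_holds`), which is construction-blocked today (secant sheaves on `J(C₃) × Ĵ(C₃)`, Orlov equivalences,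
twisted Buchweitz–Flenner/Pridham semiregularity — no carriers). ROLE IN THE LINE unchanged: the E-step's
calibration E0 must REPRODUCE this sector from an abelian SURFACE anchor `S × E` (card §E0); a failure of E0
kills the E-step as a criterion-carrier while this statement stays true in print. The planner's gen-1 stub
`∀ d, 0 < d → WeilAlgebraicSplit 3 d` (polarization = `IsPolarizationClass`, no positivity) was MISSTATED for
this purpose (worker 1, p94589: wider than print on special members); its corrected image
`∀ d, 0 < d → Stubs.WeilAlgebraicSplitHyperplane 3 d` is proved from this stub below (`splitSixfolds_holds`). -/
theorem stub_splitSixfolds : Markman2025_weilClasses_algebraic_hyperbolicSixfold := by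
  sorry

/-- STUB 2 (XL, OPEN — the line's TARGET and hardest ATTACKABLE stub, gen-3 typing) — **the E-TOWER: split Weil
`2n`-folds for every `n ≥ 4` and every `K = ℚ(√-d)`**, split = hyperbolic for a `K`-symmetrised hyperplane class
(`Stubs.WeilAlgebraicSplitHyperplane`, the tree's convention; first open instance `n = 4`: split EIGHTFOLDS, hence
all sixfolds by `stub_descend` — `weilSixfolds_of` below; in print "completely open", arXiv:2603.20268 p.3, van
Geemen LNM 1594 Thm 4.11, survey §12). INTENDED PROOF = the E-step induction on OBJECTS (invisible at class level;
this statement is its output): anchors `X_n = S × E^{n-2}`, seeds `F'₁, F'₂` on `X_{n+1} = X_n × E` obtained from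
the level-`n` seeds by ONE Hecke modification along a `G_E`-orbit of fibres with a secant quotient `Q`
(`k·ch Q = (ma−b)α + (mb+qa)β`), the three conditions of Markman's strategy (survey §4: (i) criterion
`ker ev = ann ch` + surjectivity onto `(G × G_E)`-invariants ⟹ semiregular after descent, Lemma 11.3 / Prop. 11.5
pattern; (ii) `κ` remains Hodge — automatic for secant^{⊠2} objects, arXiv:2502.03415 Cor. 1.3.2, any ample `Θ'`;
(iii) `κ_{n+1} ∉ Sym(𝒜²)`) verified INCREMENTALLY from the long exact sequences of the one defining triangle, then
BF/Pridham over the split component, Baire/Hilbert scheme, isogeny descent (tree). Why it might fail: the criterion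
is NOT obviously stable under elementary modification (`Ext²(F',F')` acquires `Ext¹(F⊠L, Q⊠𝒪_p)`- and
`Ext²(Q,Q)⊗H⁰`-terms), the surjectivity half needs `HH¹ → Ext¹(F',F')^{inv}` iso + generation for the NEW sheaf,
and for some `(n, q)` the class equation for `Q` may have no sheaf solution. Honours
`hodgeAbelianVarieties_iff_deepMiddle` (`p = n ≥ 4`, `2p = dim`). -/
theorem stub_eTower : ∀ n d : ℕ, 4 ≤ n → 0 < d → Stubs.WeilAlgebraicSplitHyperplane n d := by
  sorry

/-- STUB 3 (L; TRUE IN PRINT — DESCENDING, Schoen 1998 §10 Prop. = Koike 2004 = Markman survey §11.5 Step 2,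
all `n`; gen-3 typing) — **split `2(n+1)`-folds give ALL Weil-type `2n`-folds**: given `(A, φ)` of dimension
`2n`, `φ² = -d`, and a non-zero rational `(n,n)` Weil class (else nothing to prove), choose a Weil SURFACE
`(S, ψ)` for the same `K` of complementary discriminant ("every class of `ℚ^×/Nm K^×` is a discriminant in every
even dimension", van Geemen 5.5; discriminant multiplicative, `Motives.weilDiscriminant_bilinOrthSum`), so that
`(A × S, φ × ψ)` is HYPERBOLIC for a `K`-symmetrised hyperplane class of a (Segre) projective embedding — the
`n`-version of the tree's fact `Markman2025_exists_weilTypeSurface_prod_isHyperbolicWeilType` (stated there for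
`n = 2`); the hypothesis makes the Weil classes of `A × S` algebraic, and Schoen's Gysin transfer
`w = pr_{A*}((P₊₊ + P₋₋) ⌣ p₂^* w′)` returns to `A` — the `n`-version of the tree's fact
`Schoen1998_weilClasses_algebraic_of_prod_surface` (stated for `6 → 4`; upward half PROVED in the tree:
`WeilClassesProducts.weilEigencomponents_cupProduct_mem_algebraicClasses`; downward half = `ComplexGysin`, conditional
on `bijective_poincareDualityMap`; Schoen transfer scalars: `Theorems/HeckePrymWeilProductDescentTransfer.lean`). The
assembly of the two facts is the three-line proof of `Markman2025_weilClasses_algebraic_abelianFourfold_holds_of`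
(file `WeilClassesFourfoldsFromSixfolds`), uniform in `n`. Sources: Schoen1998HodgeWeilAddendum §10;
Markman2025SurveySecant §11.5; vanGeemen1994HodgeAV 5.2–5.5. -/
theorem stub_descend :
    ∀ n d : ℕ, 2 ≤ n → 0 < d → Stubs.WeilAlgebraicSplitHyperplane (n + 1) d → WeilAlgebraicAll n d := by
  sorry

/-- STUB 4 (XXL, OPEN — the COMPLEMENT, carried for honesty, NOT attacked by this line; promotion /
sharing candidate) — **the imaginary-quadratic Weil sector suffices for HC on abelian varieties**:
`TropicalCuspLift.WeilClassesAlgebraic` (stmt-HodgeConjecture-2522: Weil classes on every Weil-type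
`(A, φ)`, all `2n ≥ 4`, all `K = ℚ(√-d)`) ⟹ the crux. Status: implied by the crux (so irrefutable unless
HC fails); KNOWN parts in print — `dim A ≤ 5` (Moonen–Zarhin + Ramón Marí + Markman Cor. 1.3), Hodge rings
generated by divisors (Mattuck general, Tankeev prime dimension, Tate/Imai/Murasaki `Eⁿ`), CM abelian
varieties whose André decomposition (survey Thm 1.4: `t = Σ fᵢ^* tᵢ`, `tᵢ` Weil classes on split Weil-type
`Aᵢ` for CM FIELDS `Kᵢ`) involves only imaginary-quadratic `Kᵢ`; OPEN parts — Weil classes relative to CM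
fields of degree `> 2` (Markman's `[markman-CM]`, survey §12) and the CM-to-general transport (no
principle B for algebraic classes; the route's own p-adic thesis P1–P3 and `ConservativityLefschetz` aim
there). It is the AV-restriction of `TropicalCuspLift.Assembly` (summit-level complement, gate-accepted
as "NOT claimed"); filed so that `HodgeAbelianVarieties_of` concludes the crux BY NAME, as every
Weil-sector line for this crux must. Provers: land partials (`dim ≤ 5` from named facts) or leave it. -/
theorem stub_weilSectorSuffices : WeilSectorSuffices := by
  sorry

/-! ### Named statements = the registered stubs (definitionally) -/

/-- The corrected statement of the `n = 3` base (gen 3): split sixfolds in the hyperplane convention. -/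
def SplitSixfolds : Prop := ∀ d : ℕ, 0 < d → Stubs.WeilAlgebraicSplitHyperplane 3 d
/-- The statement of `stub_eTower` (gen 3). -/
def ETower : Prop := ∀ n d : ℕ, 4 ≤ n → 0 < d → Stubs.WeilAlgebraicSplitHyperplane n d
/-- The statement of `stub_descend` (gen 3). -/
def Descend : Prop :=
  ∀ n d : ℕ, 2 ≤ n → 0 < d → Stubs.WeilAlgebraicSplitHyperplane (n + 1) d → WeilAlgebraicAll n d

/-- PROVED glue (gen 3): the `n = 3` base in the hyperplane convention from STUB 1 = Markman's Thm 1.5.1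
(`Stubs.weilAlgebraicSplitHyperplane_three_iff_markman`, worker 1, p94589). -/
theorem splitSixfolds_holds : SplitSixfolds :=
  Stubs.weilAlgebraicSplitHyperplane_three_iff_markman.2 stub_splitSixfolds
theorem eTower_holds : ETower := stub_eTower
theorem descend_holds : Descend := stub_descend
theorem weilSectorSuffices_holds : WeilSectorSuffices := stub_weilSectorSuffices

/-! ### Name-keyed aliases of the four statements (the hypotheses of the composition) -/
namespace Registered

/-- Alias of stub 1's statement keyed by the registered stub name (gen 3: the literature fact). -/
abbrev stub_splitSixfolds : Prop := Markman2025_weilClasses_algebraic_hyperbolicSixfold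
/-- Alias of `ETower` keyed by the registered stub name. -/
abbrev stub_eTower : Prop := ETower
/-- Alias of `Descend` keyed by the registered stub name. -/
abbrev stub_descend : Prop := Descend
/-- Alias of `WeilSectorSuffices` keyed by the registered stub name. -/
abbrev stub_weilSectorSuffices : Prop := WeilSectorSuffices

end Registered

/-! ### Glue (proved, no `sorry`) -/

/-- Split Weil classes (hyperplane convention) in EVERY half-dimension `m ≥ 3` from the base (`m = 3`) and
the tower (`m ≥ 4`). -/
theorem weilAlgebraicSplit_of_ge_three (h₁ : SplitSixfolds) (h₂ : ETower) {m d : ℕ} (hm : 3 ≤ m)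
    (hd : 0 < d) : Stubs.WeilAlgebraicSplitHyperplane m d := by
  rcases Nat.lt_or_ge m 4 with h | h
  · obtain rfl : m = 3 := by omega
    exact h₁ d hd
  · exact h₂ m d h hd

/-- All Weil-type `2n`-folds, `n ≥ 2`, from split `2(n+1)`-folds and descending. -/
theorem weilAlgebraicAll_of (h₁ : SplitSixfolds) (h₂ : ETower) (h₃ : Descend) {n d : ℕ} (hn : 2 ≤ n)
    (hd : 0 < d) : WeilAlgebraicAll n d :=
  h₃ n d hn hd (weilAlgebraicSplit_of_ge_three h₁ h₂ (by omega) hd)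

/-- **The Weil part of the skeleton closes the tree's typed Weil target**
`TropicalCuspLift.WeilClassesAlgebraic` (stmt-HodgeConjecture-2522) — the dictionary is
`mem_weilClassesOf_iff` (the item's inline eigen-decomposition IS membership in `weilClassesOf`). -/
theorem weilClassesAlgebraic_of (h₁ : SplitSixfolds) (h₂ : ETower) (h₃ : Descend) :
    Summit.HodgeConjecture.HodgeConjecture.Theses.TropicalCuspLift.WeilClassesAlgebraic := by
  intro n hn d hd A φ hA _hX hφ c hc hH hw
  exact weilAlgebraicAll_of h₁ h₂ h₃ hn hd A φ hA hφ c (mem_weilClassesOf_iff.2 hw) hc hH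

/-- **The line's first NEW output, in the tree's terms**: split EIGHTFOLDS (`ETower` at `n = 4`) plus
descending give `TropicalCuspLift.WeilSixfolds` (stmt-HodgeConjecture-2524: Weil classes on abelian
sixfolds of EVERY discriminant — "outside [disc `-1`] … completely open", arXiv:2603.20268 p.3). -/
theorem weilSixfolds_of (h₂ : ETower) (h₃ : Descend) :
    Summit.HodgeConjecture.HodgeConjecture.Theses.TropicalCuspLift.WeilSixfolds := by
  intro d hd A φ hA _hX hφ c hc hH hw
  exact h₃ 3 d (by norm_num) hd (h₂ 4 d le_rfl hd) A φ hA hφ c (mem_weilClassesOf_iff.2 hw) hc hH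

/-! ### The composition: the four stubs imply the crux, by name -/

/-- `HodgeAbelianVarieties` from the four stub statements (pure logic; no `sorry`): STUB 1 (Markman's split
sixfolds, via `splitSixfolds`-glue) and STUB 2 (the E-tower, `n ≥ 4`) give split Weil classes in every
half-dimension `≥ 3`; STUB 3 descends them to all Weil-type `2n`-folds, `n ≥ 2`, i.e.
`TropicalCuspLift.WeilClassesAlgebraic` (`weilClassesAlgebraic_of`); STUB 4 is the complement edge to the crux. -/
theorem HodgeAbelianVarieties_of_stubs (h₁ : Registered.stub_splitSixfolds) (h₂ : Registered.stub_eTower)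
    (h₃ : Registered.stub_descend) (h₄ : Registered.stub_weilSectorSuffices) :
    Summit.HodgeConjecture.HodgeConjecture.Theses.PadicSemiregularLift.HodgeAbelianVarieties :=
  h₄ (weilClassesAlgebraic_of (Stubs.weilAlgebraicSplitHyperplane_three_iff_markman.2 h₁) h₂ h₃)

/-- **`HodgeAbelianVarieties_of` — the crux BY NAME from the four registered stubs** (hypothesis-free form fed
with the sorried stubs; the only theorem of the file whose conclusion head is the crux). -/
theorem HodgeAbelianVarieties_of :
    Summit.HodgeConjecture.HodgeConjecture.Theses.PadicSemiregularLift.HodgeAbelianVarieties :=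
  HodgeAbelianVarieties_of_stubs stub_splitSixfolds stub_eTower stub_descend stub_weilSectorSuffices

/-- Consistency with the landed Negative lemma (p70486): what the skeleton proves is literally the
summit restricted to abelian varieties — no stub is an instance the Negative file refutes (it refutes
nothing; it locates counterexamples at `2 ≤ p ≤ dim/2`, where STUBS 1–2 work). -/
example (h₁ : Registered.stub_splitSixfolds) (h₂ : ETower) (h₃ : Descend) (h₄ : WeilSectorSuffices) :
    ∀ A : AbelianVariety ℂ, IsSmoothProjective A.dim A.X → HodgeConjectureFor A.dim A.X :=
  Summit.HodgeConjecture.HodgeConjecture.Theorems.HodgeAbelianVarieties.Negative.iff_hodgeConjecture_restricted.1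
    (HodgeAbelianVarieties_of_stubs h₁ h₂ h₃ h₄)

/-- Sanity (gen 3): the planner's gen-1 split sector implies the hyperplane-typed one used now, for `0 < d`
(worker 1: `weilAlgebraicSplitPolarized_of_split`; the hyperplane shape is weaker still only through the
polarization bookkeeping — recorded, not needed by the composition). -/
example {n d : ℕ} (H : WeilAlgebraicSplit n d) : Stubs.WeilAlgebraicSplitPolarized n d :=
  Stubs.weilAlgebraicSplitPolarized_of_split H

end Summit.HodgeConjecture.HodgeConjecture.Cruxes.HodgeAbelianVarieties.EStepSecantInduction

end
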